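import Summits.ValiantsHypothesis.ValiantsHypothesis.Theorems.RigidityForcesSymmetryGrenetFirstOrderRankRigidConstGauge
import Literature.Computability.AlgebraicComplexity.GrenetAdjCells

/-!
# Route RigidityForcesSymmetry — `GrenetFirstOrderRankRigid` (item stmt-ValiantsHypothesis-21029),
line `grenet_gauge`: stub `stub_linearRigid`, step 2 — the coefficient matrices of Grenet's pencil
and the shape of rank-constrained directions

For the crux line `Cruxes/GrenetFirstOrderRankRigid/Lines/grenet_gauge.lean` (blueprint
`Lines/grenet_gauge-stub_linearRigid-PROOF.md`, §2).

* `coeff_single_grenet_adj`, `coeff_single_grenet_repr` — the coefficient matrix `A_v`,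
  `v = (j, c)`, of Grenet's pencil (`(A_v) i j' = coeff_{x_v} (Grenet.repr k n e) i j'`) is the signed
  indicator of the ARCS OF LABEL `v`: `(A_v) i j' = -ε · [j ∉ R i ∧ C j' = insert j (R i) ∧ |R i| = c]`
  (`ε = (-1)^(e univ + e ∅)`, `R i` / `C j'` the row / column vertices); in particular the row of `i`
  vanishes unless `R i` is a `v`-TAIL (`j ∉ R i`, `|R i| = c`) and the column of `j'` vanishes unless
  `C j'` is a `v`-HEAD (`j ∈ C j'`, `|C j'| = c + 1`) (`grenet_coeffMatrix_row_eq_zero`,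
  `grenet_coeffMatrix_col_eq_zero`).
* `entry_eq_zero_of_rankConstraint` — for ANY matrices `A, A'`: if `A' (ker A) ⊆ im A` (in the
  route's form `∀ w, A w = 0 → ∃ u, A' w = A u`) then `A' i j = 0` whenever the row `i` and the
  column `j` of `A` both vanish (test `w = e_j`).
* `grenet_allowed_entry` — hence a rank-constrained direction `A'` at Grenet's pencil is supported
  on the ALLOWED ENTRIES: `(A'_v) i j' ≠ 0 ⇒ R i is a v-tail ∨ C j' is a v-head`.

No new definitions.  VP ≠ VNP is not moved by this file (bookkeeping for a first-order statement
about one explicit matrix family).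
-/

noncomputable section

open MvPolynomial Matrix Finset

namespace Summit.ValiantsHypothesis.Theorems.RigidityForcesSymmetry.GrenetGauge

open Literature.Computability.AlgebraicComplexity

/-! ### The rank constraint forces zeros off the support rows and columns -/

section RankConstraint

variable {R : Type*} [Semiring R] {ι : Type*} [Fintype ι] [DecidableEq ι]

/-- **Zeros forced by the rank constraint.** If `A' (ker A) ⊆ im A` — in the route's form: every
`w` with `A w = 0` has `A' w = A u` for some `u` — then `A' i j = 0` whenever the row `i` of `A` and the
column `j` of `A` both vanish: `e_j ∈ ker A`, so `A' e_j = A u`, whose `i`-th entry is `0`. [folklore] -/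
theorem entry_eq_zero_of_rankConstraint (A A' : Matrix ι ι R)
    (hC : ∀ w, A.mulVec w = 0 → ∃ u, A'.mulVec w = A.mulVec u) {i j : ι}
    (hrow : ∀ j', A i j' = 0) (hcol : ∀ i', A i' j = 0) : A' i j = 0 := by
  have hker : A.mulVec (Pi.single j 1) = 0 := by
    ext i'
    rw [Matrix.mulVec_single_one, Matrix.col_apply, Pi.zero_apply]
    exact hcol i'
  obtain ⟨u, hu⟩ := hC _ hker
  have h := congrFun hu i
  rw [Matrix.mulVec_single_one, Matrix.col_apply] at h
  rw [h, Matrix.mulVec, dotProduct]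
  exact Finset.sum_eq_zero fun j' _ => by rw [hrow j', zero_mul]

end RankConstraint

/-! ### The coefficient matrices of Grenet's pencil -/

section Coeff

variable (k : Type*) [CommRing k] {n : ℕ}

/-- **Coefficient of `x_v` in a cell of Grenet's adjacency matrix**: for `v = (j, c)`,
`coeff_{x_v} (adj S T) = [j ∉ S ∧ T = insert j S ∧ |S| = c]` (the arc `S → insert j S` carries
`x_{j,|S|}`). [cite: Grenet2011, Thm. 1] -/
theorem coeff_single_grenet_adj (S T : Finset (Fin n)) (v : Fin n × Fin n) :
    MvPolynomial.coeff (Finsupp.single v 1) (Grenet.adj k n S T) =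
      if v.1 ∉ S ∧ T = insert v.1 S ∧ (v.2 : ℕ) = S.card then 1 else 0 := by
  by_cases h : ∃ j, j ∉ S ∧ T = insert j S
  · obtain ⟨j, hj, rfl⟩ := h
    rw [Grenet.adj_apply_insert k hj, MvPolynomial.coeff_X]
    by_cases hv : v.1 ∉ S ∧ insert j S = insert v.1 S ∧ (v.2 : ℕ) = S.card
    · obtain ⟨hv1, hins, hv2⟩ := hv
      have hj' : v.1 = j := by
        have hmem : v.1 ∈ insert j S := hins ▸ Finset.mem_insert_self v.1 S
        rcases Finset.mem_insert.mp hmem with h | h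
        · exact h
        · exact absurd h hv1
      have hvj : ((j, ⟨S.card, Grenet.card_lt_of_notMem hj⟩) : Fin n × Fin n) = v :=
        Prod.ext hj'.symm (Fin.ext hv2.symm)
      rw [hvj, if_pos rfl, if_pos ⟨hv1, hins, hv2⟩]
    · rw [if_neg hv, if_neg]
      intro heq
      rw [Finsupp.single_left_inj one_ne_zero] at heq
      subst heq
      exact hv ⟨hj, rfl, rfl⟩
  · rw [Grenet.adj_apply_of_forall_ne k fun j hj hT => h ⟨j, hj, hT⟩, MvPolynomial.coeff_zero, if_neg]
    rintro ⟨hv1, hT, -⟩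
    exact h ⟨v.1, hv1, hT⟩

/-- The sign of Grenet's matrix as a constant polynomial. [folklore] -/
theorem grenet_sign_eq_C {N : ℕ} (e : Finset (Fin n) ≃ Fin (N + 1)) :
    (-1 : MvPolynomial (Fin n × Fin n) k) ^ ((e univ : ℕ) + (e ∅ : ℕ)) = C ((-1 : k) ^ ((e univ : ℕ) + (e ∅ : ℕ))) := by
  rw [map_pow, map_neg, map_one]

variable {N : ℕ} (e : Finset (Fin n) ≃ Fin (N + 1))

/-- **The coefficient matrices of Grenet's pencil are the signed arc indicators**: for `v = (j, c)`,
`coeff_{x_v} (Grenet.repr k n e) i j' = -ε · [j ∉ R i ∧ C j' = insert j (R i) ∧ |R i| = c]` with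
`ε = (-1)^(e univ + e ∅)`, `R i = e⁻¹((e univ).succAbove i)`, `C j' = e⁻¹((e ∅).succAbove j')`.
[cite: Grenet2011, Thm. 1] -/
theorem coeff_single_grenet_repr (i j' : Fin N) (v : Fin n × Fin n) :
    MvPolynomial.coeff (Finsupp.single v 1) (Grenet.repr k n e i j') =
      -((-1 : k) ^ ((e univ : ℕ) + (e ∅ : ℕ))) *
        if v.1 ∉ e.symm ((e univ).succAbove i) ∧
            e.symm ((e ∅).succAbove j') = insert v.1 (e.symm ((e univ).succAbove i)) ∧
            (v.2 : ℕ) = (e.symm ((e univ).succAbove i)).card then 1 else 0 := by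
  rw [Grenet.repr, Matrix.smul_apply, Matrix.submatrix_apply, Matrix.submatrix_apply, smul_eq_mul,
    grenet_sign_eq_C, MvPolynomial.coeff_C_mul, Matrix.sub_apply, MvPolynomial.coeff_sub,
    coeff_single_grenet_adj, Matrix.one_apply]
  have h0 : MvPolynomial.coeff (Finsupp.single v 1)
      (if e.symm ((e univ).succAbove i) = e.symm ((e ∅).succAbove j') then (1 : MvPolynomial (Fin n × Fin n) k) else 0) = 0 := by
    split_ifs
    · rw [MvPolynomial.coeff_one, if_neg]
      exact Ne.symm (Finsupp.single_ne_zero.mpr one_ne_zero)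
    · exact MvPolynomial.coeff_zero _
  rw [h0, zero_sub, mul_neg, neg_mul]

/-- A row of a coefficient matrix of Grenet's pencil vanishes unless its vertex is a tail of an arc of
that label: `coeff_{x_(j,c)} (Grenet.repr) i j' = 0` for all `j'` unless `j ∉ R i` and `|R i| = c`.
[cite: Grenet2011, Thm. 1] -/
theorem grenet_coeffMatrix_row_eq_zero {i : Fin N} {v : Fin n × Fin n}
    (h : ¬ (v.1 ∉ e.symm ((e univ).succAbove i) ∧ (v.2 : ℕ) = (e.symm ((e univ).succAbove i)).card))
    (j' : Fin N) : MvPolynomial.coeff (Finsupp.single v 1) (Grenet.repr k n e i j') = 0 := by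
  rw [coeff_single_grenet_repr, if_neg fun h' => h ⟨h'.1, h'.2.2⟩, mul_zero]

/-- A column of a coefficient matrix of Grenet's pencil vanishes unless its vertex is a head of an arc
of that label: `coeff_{x_(j,c)} (Grenet.repr) i j' = 0` for all `i` unless `j ∈ C j'` and
`|C j'| = c + 1`. [cite: Grenet2011, Thm. 1] -/
theorem grenet_coeffMatrix_col_eq_zero {j' : Fin N} {v : Fin n × Fin n}
    (h : ¬ (v.1 ∈ e.symm ((e ∅).succAbove j') ∧ (e.symm ((e ∅).succAbove j')).card = (v.2 : ℕ) + 1))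
    (i : Fin N) : MvPolynomial.coeff (Finsupp.single v 1) (Grenet.repr k n e i j') = 0 := by
  rw [coeff_single_grenet_repr, if_neg, mul_zero]
  rintro ⟨hv1, hins, hv2⟩
  refine h ⟨?_, ?_⟩
  · rw [hins]
    exact Finset.mem_insert_self _ _
  · rw [hins, Finset.card_insert_of_notMem hv1, hv2]

/-- **Allowed entries of a rank-constrained direction at Grenet's pencil.** If `A'_v (ker A_v) ⊆ im A_v`
for the coefficient matrix `A_v = coeff_{x_v} (Grenet.repr k n e)`, `v = (j, c)`, then every nonzero
entry `(A'_v) i j'` has its row vertex a `v`-tail (`j ∉ R i`, `|R i| = c`) or its column vertex a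
`v`-head (`j ∈ C j'`, `|C j'| = c + 1`). [folklore] -/
theorem grenet_allowed_entry {A : Matrix (Fin N) (Fin N) k} {v : Fin n × Fin n}
    (hA : ∀ i j', A i j' = MvPolynomial.coeff (Finsupp.single v 1) (Grenet.repr k n e i j'))
    (A' : Matrix (Fin N) (Fin N) k) (hC : ∀ w, A.mulVec w = 0 → ∃ u, A'.mulVec w = A.mulVec u)
    {i j' : Fin N} (hne : A' i j' ≠ 0) :
    (v.1 ∉ e.symm ((e univ).succAbove i) ∧ (v.2 : ℕ) = (e.symm ((e univ).succAbove i)).card) ∨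
      (v.1 ∈ e.symm ((e ∅).succAbove j') ∧ (e.symm ((e ∅).succAbove j')).card = (v.2 : ℕ) + 1) := by
  by_contra h
  push Not at h
  refine hne (entry_eq_zero_of_rankConstraint A A' hC (fun j'' => ?_) (fun i'' => ?_))
  · rw [hA]
    exact grenet_coeffMatrix_row_eq_zero k e (fun h' => h.1 h'.1 h'.2) j''
  · rw [hA]
    exact grenet_coeffMatrix_col_eq_zero k e (fun h' => h.2 h'.1 h'.2) i''

end Coeff

end Summit.ValiantsHypothesis.Theorems.RigidityForcesSymmetry.GrenetGauge
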